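import Summits.AtomisticToContinuum.HydrodynamicLimit.Theorems.BoxDissipativeWeakStrongLocalGibbsFineScalePos

/-!
# Route `BoxDissipativeWeakStrong` — `LocalGibbsFineScale` (item stmt-AtomisticToContinuum-17712)

The fine-scale initial law of large numbers (K0 of the dissipative-box closure card): for continuous
profiles `a₀, θ₀ > 0`, `u₀`, reduced densities `σ < σ₀`, every classical hard-sphere–Euler solution
`(ρ, u, θ)` on `[0, T)` with `0 < T` whose `t = 0` fields are the macroscopic LLN limit of the local
Gibbs laws, every flow family and every kinetic window `ℓ_N` (`0 < ℓ_N ≤ 1`, `ℓ_N → 0`,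
`(N+1) ℓ_N³ → ∞`), the box fields at `t = 0` converge in `L¹(P_N ⊗ dx)`:
`E_P ∫ (|ρ̂ − ρ(0,·)| + ‖m̂ − ρu(0,·)‖ + |Ê − E(0,·)|) dx → 0`.

The item was re-typed (route repair rev 7, 2026-08-16) with the hypothesis `0 < T` inserted after
`IsHardSphereEulerSolution σ T ρ u θ`; with that hypothesis the route declaration is, verbatim, the
statement of `LGFS.localGibbsFineScale_of_pos`
(`Theorems/BoxDissipativeWeakStrongLocalGibbsFineScalePos.lean`: low-activity cluster expansion for
the statics, Gaussian velocities, identification of the continuous limit profiles through the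
macroscopic hypothesis and uniqueness of limits in probability). This file is the one-line closing
step.

References: Ruelle1969, LebowitzPenrose1964 (low-density statics), Spohn1991 (local Gibbs states).
-/

namespace Summit.AtomisticToContinuum.HydrodynamicLimit.Theorems

/-- **`LocalGibbsFineScale` holds** (item stmt-AtomisticToContinuum-17712, route
`BoxDissipativeWeakStrong`): the fine-scale `t = 0` law of large numbers for the box fields under
the local Gibbs laws, for positive existence times `0 < T`. Immediate from
`LGFS.localGibbsFineScale_of_pos`, whose statement is the unfolded route declaration. -/
theorem localGibbsFineScale_proof :
    Summit.AtomisticToContinuum.HydrodynamicLimit.Theses.BoxDissipativeWeakStrong.LocalGibbsFineScale := by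
  unfold Summit.AtomisticToContinuum.HydrodynamicLimit.Theses.BoxDissipativeWeakStrong.LocalGibbsFineScale
  exact LGFS.localGibbsFineScale_of_pos

end Summit.AtomisticToContinuum.HydrodynamicLimit.Theorems
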